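import Summits.AtomisticToContinuum.FouriersLaw.Theses.LatticeLandauDamping

/-!
# Birth skeleton — crux `WindowDecomposition` (stmt-AtomisticToContinuum-14011)

Route `route-AtomisticToContinuum-LatticeLandauDamping`, sub-problem `FouriersLaw`.
BC3 skeleton (skeleton-register, planner one-shot 2026-08-17): three NAMED stubs and the
kernel-checked composition `WindowDecomposition_of` concluding the crux BY NAME.

The line is the route's own TWO-LAYER PLAN read operator-free
(`LadderFramework → DegreeMourreR → WindowDecomposition`, glue = limiting absorption + Stieltjes
inversion):

* `stub_currentSpectralMeasure` (framework, L): infinite-volume set-up at every `T > 0` — a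
  shift-invariant Gibbs state `μ_T`, a `μ_T`-preserving infinite-volume dynamics with absolutely
  convergent summed current correlations, and (Bochner, for the even positive-definite `C_T`) a
  finite SYMMETRIC spectral measure `σ_T` with `C_T(t) = ∫ cos(ωt) dσ_T(ω)`.
* `stub_zeroFrequencyLAP` (the load-bearing stub, open): LIMITING ABSORPTION AT FREQUENCY ZERO in
  measure language — for every admissible `(μ_T, D)` and every finite symmetric `σ` representing
  `C_T`, the Poisson smoothings `P_ε[σ|_{ω ≠ 0}](ω) = π⁻¹ ∫ ε / ((ω − ω')² + ε²) dσ|_{ω≠0}(ω')`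
  (= `π⁻¹ Im ⟨J', (𝓛 − ω − iε)⁻¹ J'⟩`, `J'` = current class minus its hydrodynamic projection)
  converge UNIFORMLY on a closed window `[−δ, δ]`, `δ > 0`, as `ε ↓ 0`. The possible Drude atom
  AT 0 is removed before smoothing (it is `NoDrudeWeight`'s business), exactly as in the crux.
* `stub_stieltjesInversion` (real analysis, M, provable now): if the Poisson smoothings of a
  finite measure `ρ` on `ℝ` converge uniformly on `[−δ, δ]` to `g`, then `g` is continuous and
  `≥ 0` on `(−δ, δ)` and `ρ|_{(−δ,δ)} = g dω` (approximate identity + Riesz uniqueness on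
  `C_c`; tree support: `Theorems.MourreDissolution.pi_mul_integral_eq_of_tendstoUniformlyOn`,
  `restrict_Ioo_eq_withDensity_of_forall_integral`, kernel `ν/((x−ω)²+ν²)`, density `h/π`).

`WindowDecomposition_of : Sig.stub_currentSpectralMeasure → Sig.stub_zeroFrequencyLAP →
Sig.stub_stieltjesInversion → WindowDecomposition` (no sorry; axioms propext / Classical.choice /
Quot.sound) = obtain the data from the first stub, the window from the second, invert with the third,
and reassemble `σ|_{(−δ,δ)} = σ{0}·δ_0 + g dω` by measure algebra (`restrict_add_restrict_compl`,
`restrict_restrict`, `restrict_singleton`).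

File map: §1 `Sig.stub_<name> : Prop` — the three stub STATEMENTS (named, so that the composition's
hypotheses are the declared stubs BY NAME); §2 `theorem stub_<name> : <statement verbatim> := by sorry` —
the registered stubs (the ONLY sorries); §3 `WindowDecomposition_of` — the composition, the unique
declaration concluding the crux; §4 an `example` instantiating it through the sorried stubs.

Disproof used: none — no `Disproof.lean` is filed on this crux (`ledger crux ls`, 2026-08-17).
-/

namespace Summit.AtomisticToContinuum.FouriersLaw.Cruxes.WindowDecomposition.Birth

open MeasureTheory Filter Set
open Literature.MathematicalPhysics.KineticTheory.HeatConduction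
open Summit.AtomisticToContinuum.FouriersLaw.Theses.LatticeLandauDamping (WindowDecomposition)

/-! ## §1 The stub statements (named) -/

/-- Statement of `stub_currentSpectralMeasure` (framework: state, dynamics, symmetric spectral measure). -/
def Sig.stub_currentSpectralMeasure : Prop :=
    ∀ ω₂ lam β γ : ℝ, 0 < ω₂ → 0 < lam → 0 < β → 0 < γ → ∀ T : ℝ, 0 < T →
      ∃ (μT : Measure ChainConfig) (D : InfiniteChainDynamics (pinnedChain ω₂ lam β γ)),
        (pinnedChain ω₂ lam β γ).IsChainGibbsMeasure T μT ∧
        (∀ x : ℤ, MeasurePreserving (fun σ : ChainConfig => fun i : ℤ => σ (i + x)) μT μT) ∧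
        D.PreservesMeasure μT ∧ (∀ t : ℝ, D.HasAbsConvergentCorrelation μT t) ∧
        ∃ σ : Measure ℝ, IsFiniteMeasure σ ∧ σ.map (fun ω : ℝ => -ω) = σ ∧
          ∀ t : ℝ, D.currentCorrelation μT t =
            MeasureTheory.integral σ (fun ω : ℝ => Real.cos (ω * t))

/-- Statement of `stub_zeroFrequencyLAP` (LOAD-BEARING: uniform Poisson boundary values of the
atom-free spectral measure on a closed window around frequency 0). -/
def Sig.stub_zeroFrequencyLAP : Prop :=
    ∀ ω₂ lam β γ : ℝ, 0 < ω₂ → 0 < lam → 0 < β → 0 < γ → ∀ T : ℝ, 0 < T →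
      ∀ (μT : Measure ChainConfig) (D : InfiniteChainDynamics (pinnedChain ω₂ lam β γ)),
        (pinnedChain ω₂ lam β γ).IsChainGibbsMeasure T μT →
        (∀ x : ℤ, MeasurePreserving (fun σ : ChainConfig => fun i : ℤ => σ (i + x)) μT μT) →
        D.PreservesMeasure μT → (∀ t : ℝ, D.HasAbsConvergentCorrelation μT t) →
        ∀ σ : Measure ℝ, IsFiniteMeasure σ → σ.map (fun ω : ℝ => -ω) = σ →
          (∀ t : ℝ, D.currentCorrelation μT t =
            MeasureTheory.integral σ (fun ω : ℝ => Real.cos (ω * t))) →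
          ∃ (δ : ℝ) (g : ℝ → ℝ), 0 < δ ∧
            TendstoUniformlyOn
              (fun ε ω : ℝ => Real.pi⁻¹ *
                MeasureTheory.integral (σ.restrict {0}ᶜ) (fun ω' : ℝ => ε / ((ω' - ω) ^ 2 + ε ^ 2)))
              g (nhdsWithin (0 : ℝ) (Set.Ioi 0)) (Set.Icc (-δ) δ)

/-- Statement of `stub_stieltjesInversion` (real analysis: uniform LAP on `[−δ, δ]` ⇒ continuous
non-negative density on `(−δ, δ)`). -/
def Sig.stub_stieltjesInversion : Prop :=
    ∀ (ρ : Measure ℝ), IsFiniteMeasure ρ → ∀ (δ : ℝ) (g : ℝ → ℝ),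
      TendstoUniformlyOn
        (fun ε ω : ℝ => Real.pi⁻¹ *
          MeasureTheory.integral ρ (fun ω' : ℝ => ε / ((ω' - ω) ^ 2 + ε ^ 2)))
        g (nhdsWithin (0 : ℝ) (Set.Ioi 0)) (Set.Icc (-δ) δ) →
      ContinuousOn g (Set.Ioo (-δ) δ) ∧ (∀ ω ∈ Set.Ioo (-δ) δ, 0 ≤ g ω) ∧
        ρ.restrict (Set.Ioo (-δ) δ) =
          (volume.restrict (Set.Ioo (-δ) δ)).withDensity (fun ω => ENNReal.ofReal (g ω))

/-! ## §2 The registered stubs (the only `sorry`s of the file) -/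

/-- STUB 1 (framework; size L). Infinite-volume set-up + Bochner: at every `T > 0` a
shift-invariant Gibbs state, a measure-preserving infinite-volume dynamics with absolutely
convergent summed current correlations, and a finite symmetric spectral measure `σ` of the current
with `C_T(t) = ∫ cos(ωt) dσ(ω)`. [LanfordLebowitzLieb1977, ButtaEtAl2007, Doyon2022; tree:
`InfiniteVolumeSetup` (proved, 0743), `Literature.Analysis.FunctionSpaces.IsPositiveDefinite` +
Bochner] -/
theorem stub_currentSpectralMeasure :
    ∀ ω₂ lam β γ : ℝ, 0 < ω₂ → 0 < lam → 0 < β → 0 < γ → ∀ T : ℝ, 0 < T →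
      ∃ (μT : Measure ChainConfig) (D : InfiniteChainDynamics (pinnedChain ω₂ lam β γ)),
        (pinnedChain ω₂ lam β γ).IsChainGibbsMeasure T μT ∧
        (∀ x : ℤ, MeasurePreserving (fun σ : ChainConfig => fun i : ℤ => σ (i + x)) μT μT) ∧
        D.PreservesMeasure μT ∧ (∀ t : ℝ, D.HasAbsConvergentCorrelation μT t) ∧
        ∃ σ : Measure ℝ, IsFiniteMeasure σ ∧ σ.map (fun ω : ℝ => -ω) = σ ∧
          ∀ t : ℝ, D.currentCorrelation μT t =
            MeasureTheory.integral σ (fun ω : ℝ => Real.cos (ω * t)) := by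
  sorry

/-- STUB 2 (LOAD-BEARING; open). Limiting absorption at frequency zero, operator-free: for every
admissible `(μ_T, D)` and every finite symmetric `σ` with `C_T = ∫ cos(ωt) dσ`, the Poisson
smoothings of `σ` with its atom at `0` removed converge uniformly on some closed window
`[−δ, δ]`, `δ > 0`, as `ε ↓ 0` (a closed sub-window of the open Mourre window). To be proved by a positive commutator in the momentum-Hermite DEGREE
variable (conjugate operator `A = −(Rφ(𝒩) + φ(𝒩)R†)`, floor gap `ω₂`, reduced LAP at the embedded
eigenvalue `0`). [CattaneoGrafHunziker2006 Thm 1.5, Sahbani1997, ABG 1996 Ch. 7,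
doi:10.1016/j.jmaa.2016.01.078] -/
theorem stub_zeroFrequencyLAP :
    ∀ ω₂ lam β γ : ℝ, 0 < ω₂ → 0 < lam → 0 < β → 0 < γ → ∀ T : ℝ, 0 < T →
      ∀ (μT : Measure ChainConfig) (D : InfiniteChainDynamics (pinnedChain ω₂ lam β γ)),
        (pinnedChain ω₂ lam β γ).IsChainGibbsMeasure T μT →
        (∀ x : ℤ, MeasurePreserving (fun σ : ChainConfig => fun i : ℤ => σ (i + x)) μT μT) →
        D.PreservesMeasure μT → (∀ t : ℝ, D.HasAbsConvergentCorrelation μT t) →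
        ∀ σ : Measure ℝ, IsFiniteMeasure σ → σ.map (fun ω : ℝ => -ω) = σ →
          (∀ t : ℝ, D.currentCorrelation μT t =
            MeasureTheory.integral σ (fun ω : ℝ => Real.cos (ω * t))) →
          ∃ (δ : ℝ) (g : ℝ → ℝ), 0 < δ ∧
            TendstoUniformlyOn
              (fun ε ω : ℝ => Real.pi⁻¹ *
                MeasureTheory.integral (σ.restrict {0}ᶜ) (fun ω' : ℝ => ε / ((ω' - ω) ^ 2 + ε ^ 2)))
              g (nhdsWithin (0 : ℝ) (Set.Ioi 0)) (Set.Icc (-δ) δ) := by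
  sorry

/-- STUB 3 (real analysis; size M, provable now). Stieltjes inversion under a uniform limiting
absorption principle: if the Poisson smoothings `P_ε[ρ](ω) = π⁻¹ ∫ ε / ((ω' − ω)² + ε²) dρ(ω')`
of a finite measure `ρ` on `ℝ` converge uniformly on `[−δ, δ]` to `g` as `ε ↓ 0`, then `g` is
continuous and non-negative on `(−δ, δ)` and `ρ|_{(−δ,δ)} = g dω` (uniform limit of continuous
functions; the Poisson kernel is an approximate identity; two finite measures on the window with
the same integrals of `C_c` functions coincide). Tree support (sibling crux `MourreDissolution`):
`Theorems.MourreDissolution.pi_mul_integral_eq_of_tendstoUniformlyOn` and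
`restrict_Ioo_eq_withDensity_of_forall_integral` (there with `h = π·g`, continuity assumed).
[folklore; Teschl, *Mathematical Methods in Quantum Mechanics* Thm 3.21 (Stieltjes inversion)] -/
theorem stub_stieltjesInversion :
    ∀ (ρ : Measure ℝ), IsFiniteMeasure ρ → ∀ (δ : ℝ) (g : ℝ → ℝ),
      TendstoUniformlyOn
        (fun ε ω : ℝ => Real.pi⁻¹ *
          MeasureTheory.integral ρ (fun ω' : ℝ => ε / ((ω' - ω) ^ 2 + ε ^ 2)))
        g (nhdsWithin (0 : ℝ) (Set.Ioi 0)) (Set.Icc (-δ) δ) →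
      ContinuousOn g (Set.Ioo (-δ) δ) ∧ (∀ ω ∈ Set.Ioo (-δ) δ, 0 ≤ g ω) ∧
        ρ.restrict (Set.Ioo (-δ) δ) =
          (volume.restrict (Set.Ioo (-δ) δ)).withDensity (fun ω => ENNReal.ofReal (g ω)) := by
  sorry

/-! ## §3 The composition -/

/-- COMPOSITION (kernel-checked, no sorry): the three stubs, BY NAME, give the crux
`Summit.AtomisticToContinuum.FouriersLaw.Theses.LatticeLandauDamping.WindowDecomposition`.
Proof: data from stub 1, window + uniform Poisson limit `g` from stub 2 applied to the atom-free part
`σ|_{ω≠0}`, continuity / sign / density from stub 3, then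
`σ|_I = (σ|_{0} + σ|_{ω≠0})|_I = σ{0}·δ_0 + g dω|_I` for `I = (−δ, δ) ∋ 0`. -/
theorem WindowDecomposition_of :
    Sig.stub_currentSpectralMeasure → Sig.stub_zeroFrequencyLAP → Sig.stub_stieltjesInversion →
      WindowDecomposition := by
  intro h1 h2 h3 ω₂ lam β γ hω hl hβ hγ T hT
  obtain ⟨μT, D, hGibbs, hshift, hpres, habs, σ, hfin, hsymm, hC⟩ :=
    h1 ω₂ lam β γ hω hl hβ hγ T hT
  obtain ⟨δ, g, hδ, hLAP⟩ :=
    h2 ω₂ lam β γ hω hl hβ hγ T hT μT D hGibbs hshift hpres habs σ hfin hsymm hC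
  haveI : IsFiniteMeasure σ := hfin
  obtain ⟨hcont, hnonneg, hdens⟩ := h3 (σ.restrict {0}ᶜ) inferInstance δ g hLAP
  refine ⟨μT, D, hGibbs, hshift, hpres, habs, σ, hfin, hC, δ, g, hδ, hcont, hnonneg, ?_⟩
  -- measure algebra on the window I = (−δ, δ), which contains 0
  have hI : MeasurableSet (Set.Ioo (-δ) δ) := measurableSet_Ioo
  have h0 : (0 : ℝ) ∈ Set.Ioo (-δ) δ := ⟨by linarith, hδ⟩
  have hI0 : Set.Ioo (-δ) δ ∩ {0} = {0} :=
    Set.inter_eq_right.mpr (Set.singleton_subset_iff.mpr h0)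
  calc σ.restrict (Set.Ioo (-δ) δ)
      = (σ.restrict {0} + σ.restrict {0}ᶜ).restrict (Set.Ioo (-δ) δ) := by
        rw [Measure.restrict_add_restrict_compl (measurableSet_singleton 0)]
    _ = (σ.restrict {0}).restrict (Set.Ioo (-δ) δ) +
          (σ.restrict {0}ᶜ).restrict (Set.Ioo (-δ) δ) := Measure.restrict_add _ _ _
    _ = σ.restrict {0} +
          (volume.restrict (Set.Ioo (-δ) δ)).withDensity (fun ω => ENNReal.ofReal (g ω)) := by
        rw [hdens, Measure.restrict_restrict hI, hI0]
    _ = σ {0} • Measure.dirac 0 +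
          (volume.restrict (Set.Ioo (-δ) δ)).withDensity (fun ω => ENNReal.ofReal (g ω)) := by
        rw [Measure.restrict_singleton]

/-! ## §4 Instantiation through the sorried stubs (an `example`: registers nothing and leaves
`WindowDecomposition_of` the unique declaration concluding the crux) -/

example : WindowDecomposition :=
  WindowDecomposition_of stub_currentSpectralMeasure stub_zeroFrequencyLAP stub_stieltjesInversion

end Summit.AtomisticToContinuum.FouriersLaw.Cruxes.WindowDecomposition.Birth
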